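import Summits.AtomisticToContinuum.Crystallization.Theorems.FrustratedLawDichotomyStrainedPatchHomExemptZeroStep
import Summits.AtomisticToContinuum.Crystallization.Theorems.FrustratedLawDichotomyStrainedPatchHomSlabConfine
import Summits.AtomisticToContinuum.Crystallization.Theorems.FrustratedLawDichotomyStrainedPatchHomCurvLJAnisoM
import Summits.AtomisticToContinuum.Crystallization.Theorems.FrustratedLawDichotomyStrainedPatchHomForceJacTwo

/-!
# THE ANALYTIC-SLAB LEAF, REAL SIDE: matrix-shifted floor on the label union, confined ξ-box, and the `hver` conclusion from the parts
# (27623 `(H) HomFloor (1/625)`, hcp half; critic rows 1108 (3) (iii) / 1110 (2): «entryLeafOKHT + _sound»)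

decomp-a2c hand-1 g29 (crux `AperiodicFrustratedLawGap`, stmt-AtomisticToContinuum-27623).  This def-free file fixes the INTERFACE of the ξ-box leaf
`entryLeafOKHT` (kernel Boolean = g30): every hypothesis below is literally the conclusion of a landed kernel-soundness theorem, and the conclusion is the
`hver` disjunction of `…HomEntryFlipHcp.hcpHalf_of_entryTreeShuf` / `…HomCurvLeafHCC.hcpHalf_of_entryTreeHCCX` at one point `(U, ξ)` of the box.

* §1 ★★ `jac_floorM_of_three_checks` — `curvCheckLJM` (near labels, matrix shift `D`, floor `lam₁`) + two sqrt-free `forceJacCheckN` chunks (floors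
  `lam₂`, `lam₃`) on pairwise disjoint lists ⟹ `((lam₁+lam₂+lam₃)/SC)‖Δ‖² + Σ_ij (D_ij/SC)Δ_iΔ_j ≤ Σ_{union} segGd` along the segment (`Δ = U(ξ−ξ₀)`) —
  the `hcurv` input of `…HomExemptZeroStep.slab_or_exempt_of_ring` with `q := Q(Δ)`;
* §2 ★ `abs_coord_le_of_confined` — from `|Δ_j| ≤ r_j` (all `j`) and the entry deviations `Σ_j |U_kj − δ_kj| ≤ κ_k`:
  `|(ξ − ξ₀)_k| ≤ r_k + κ_k·(4/3)·√(Σ_j r_j²)` — the CONFINED ξ-BOX about the reference shuffle on which the inner (fit / quick / energy) verdict is run;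
* §3 ★★★ `hver_of_slabParts` — at a point `(U, ξ)` of a box with reference shuffle `ξ₀`: certainly-inside label finset `B ⊆ [−11,11]³`, straddlers in `R`
  and `≥ 6`, the Q-floor of §1 (any `Q`), the reference force bound `f₀`, and «slab ⟹ conclusion» (`Q(Δ) ≤ (S₇♯(7)+f₀+|R|·6⁻⁷)‖Δ‖ → hver-conclusion`, which
  the leaf discharges by §2 + `…HomSlabConfine.abs_apply_le_of_qcert` + the inner verdict's soundness on the confined box) ⟹ the `hver` conclusion
  (dichotomy for EVERY enumeration of the homogeneous ball, or the energy floor).  The exempt branch serves every enumeration at once.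

NO definitions; 0 sorry; standard axioms; no instances / notation / `#eval`.  `--supports stmt-AtomisticToContinuum-27623`.
-/

noncomputable section

namespace Summit.AtomisticToContinuum.Crystallization.Theorems.FrustratedLawDichotomyStrainedPatchHomSlabLeaf

open scoped BigOperators RealInnerProductSpace
open Literature.Analysis.ValidatedNumerics.Numerics
open Summit.AtomisticToContinuum.Crystallization.Theorems.ChargedEnergyGapNegative (E3)
open Summit.AtomisticToContinuum.Crystallization.Theorems.FrustratedLawDichotomySchurCut (effPot w₄₅ ω₄)
open Summit.AtomisticToContinuum.Crystallization.Theorems.FrustratedLawDichotomyAveragingRuleTightFree (TightNearCap BadNearCap)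
open Summit.AtomisticToContinuum.Crystallization.Theorems.FrustratedLawDichotomyExemptAbsorption (ExemptNear)
open Summit.AtomisticToContinuum.Crystallization.Theorems.FrustratedLawDichotomyStrainedPatchHomSplit (ExRec latPt hexFrame hcpShift)
open Summit.AtomisticToContinuum.Crystallization.Theorems.FrustratedLawDichotomyStrainedPatchTaylorChord (segGd)
open Summit.AtomisticToContinuum.Crystallization.Theorems.FrustratedLawDichotomyStrainedPatchHomCoords (apply_eq_sum_entries coord_mem_cube_of_norm_le)
open Summit.AtomisticToContinuum.Crystallization.Theorems.FrustratedLawDichotomyStrainedPatchHomPolar (norm_apply_ge_of_norm_sub_one_le)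
open Summit.AtomisticToContinuum.Crystallization.Theorems.FrustratedLawDichotomyStrainedPatchHomCurvLJ
  (curvCheckLJM curvLJ_floorM_of_check)
open Summit.AtomisticToContinuum.Crystallization.Theorems.FrustratedLawDichotomyStrainedPatchHomForceJacN
  (forceJacCheckN forceJac_floor_of_checkN segGd_sum_eq_hessForm)
open Summit.AtomisticToContinuum.Crystallization.Theorems.FrustratedLawDichotomyStrainedPatchHomExemptZeroStep (slab_or_exempt_of_ring)

/-! ## §1. ★★ The matrix-shifted floor on the label union -/

/-- ★★ **MATRIX-SHIFTED JACOBIAN FLOOR OF THE UNION FROM THREE BOOLEANS**: `curvCheckLJM c w Lc Ln D lam₁` on the near labels, `forceJacCheckN` with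
floors `lam₂`, `lam₃` (possibly negative) on two far chunks `Lf`, `Lg`, the list `((Lc ++ Ln) ++ Lf) ++ Lg` duplicate-free ⟹ for `U` in the entry box
(`‖U − 1‖ ≤ 1/4`), shuffles `ξ₀, ξ` in the box of norm `≤ 1/4`, every `s ∈ (0,1)`:
`((lam₁+lam₂+lam₃)/SC)‖U(ξ−ξ₀)‖² + Σ_ij (D_ij/SC)(U(ξ−ξ₀))_i(U(ξ−ξ₀))_j ≤ Σ_{b ∈ union} segGd (r ↦ r⁻⁷ − r⁻¹³) (latPt U hexFrame b + U(hcpShift+ξ₀)) (U(ξ−ξ₀)) s`.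
[folklore: curvature sums add over disjoint label families] -/
theorem jac_floorM_of_three_checks {c w : (Fin 3 × Fin 3) ⊕ Fin 3 → ℤ} {Lc Ln Lf Lg : List (Fin 3 → ℤ)} (hL : (((Lc ++ Ln) ++ Lf) ++ Lg).Nodup)
    {D : Fin 3 → Fin 3 → ℤ} {lam₁ lam₂ lam₃ : ℤ} (h₁ : curvCheckLJM c w Lc Ln D lam₁ = true) (h₂ : forceJacCheckN c w Lf lam₂ = true)
    (h₃ : forceJacCheckN c w Lg lam₃ = true) (U : E3 →L[ℝ] E3) (hU : ‖U - 1‖ ≤ 1 / 4)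
    (hbox : ∀ ab : Fin 3 × Fin 3, |(U (EuclideanSpace.single ab.2 (1 : ℝ))) ab.1 - (c (Sum.inl ab) : ℝ) / SC| ≤ (w (Sum.inl ab) : ℝ) / SC)
    (ξ₀ ξ : E3) (hξ₀ : ∀ i : Fin 3, |ξ₀ i - (c (Sum.inr i) : ℝ) / SC| ≤ (w (Sum.inr i) : ℝ) / SC)
    (hξ : ∀ i : Fin 3, |ξ i - (c (Sum.inr i) : ℝ) / SC| ≤ (w (Sum.inr i) : ℝ) / SC) (hn₀ : ‖ξ₀‖ ≤ 1 / 4) (hn : ‖ξ‖ ≤ 1 / 4)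
    {s : ℝ} (hs : s ∈ Set.Ioo (0 : ℝ) 1) :
    ((lam₁ + lam₂ + lam₃ : ℤ) : ℝ) / SC * ‖U (ξ - ξ₀)‖ ^ 2 + ∑ i : Fin 3, ∑ j : Fin 3, (D i j : ℝ) / SC * ((U (ξ - ξ₀)) i * (U (ξ - ξ₀)) j) ≤
      ∑ b ∈ ((((Lc ++ Ln) ++ Lf) ++ Lg)).toFinset,
        segGd (fun x : ℝ => x⁻¹ ^ 7 - x⁻¹ ^ 13) (latPt U hexFrame b + U (hcpShift + ξ₀)) (U (ξ - ξ₀)) s := by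
  classical
  obtain ⟨hL12, hLg, hdisj3⟩ := List.nodup_append.1 hL
  obtain ⟨hL1, hLf, hdisj2⟩ := List.nodup_append.1 hL12
  have hdisj3' : List.Disjoint ((Lc ++ Ln) ++ Lf) Lg := fun a ha hb => hdisj3 a ha a hb rfl
  have hdisj2' : List.Disjoint (Lc ++ Ln) Lf := fun a ha hb => hdisj2 a ha a hb rfl
  have k₁ := curvLJ_floorM_of_check hL1 h₁ U hU hbox ξ₀ ξ hξ₀ hξ hn₀ hn hs
  have k₂ := forceJac_floor_of_checkN hLf h₂ U hbox ξ₀ ξ hξ₀ hξ hs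
  have k₃ := forceJac_floor_of_checkN hLg h₃ U hbox ξ₀ ξ hξ₀ hξ hs
  rw [← segGd_sum_eq_hessForm Lf.toFinset hU hn₀ hn (Set.Ioo_subset_Icc_self hs)] at k₂
  rw [← segGd_sum_eq_hessForm Lg.toFinset hU hn₀ hn (Set.Ioo_subset_Icc_self hs)] at k₃
  rw [List.toFinset_append, Finset.sum_union (List.disjoint_toFinset_iff_disjoint.2 hdisj3'), List.toFinset_append,
    Finset.sum_union (List.disjoint_toFinset_iff_disjoint.2 hdisj2')]
  have hcast : ((lam₁ + lam₂ + lam₃ : ℤ) : ℝ) / SC = (lam₁ : ℝ) / SC + (lam₂ : ℝ) / SC + (lam₃ : ℝ) / SC := by push_cast; ring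
  rw [hcast]
  nlinarith [k₁, k₂, k₃]

/-! ## §2. ★ The confined ξ-box -/

/-- ★ **THE CONFINED ξ-BOX**: `‖U − 1‖ ≤ 1/4`, `|(U y)_j| ≤ r_j` for all `j` and the row deviations `Σ_j |U_kj − δ_kj| ≤ κ_k` of the entry matrix
(`U_kj = (U e_j)_k`) give `|y_k| ≤ r_k + κ_k·(4/3)·√(Σ_j r_j²)`: `y_k = (U y)_k − ((U − 1) y)_k`, `|((U − 1)y)_k| ≤ κ_k‖y‖`, `‖y‖ ≤ (4/3)‖U y‖ ≤ (4/3)√(Σ r_j²)`.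
[folklore] -/
theorem abs_coord_le_of_confined {U : E3 →L[ℝ] E3} (hU : ‖U - 1‖ ≤ 1 / 4) (y : E3) {r κ : Fin 3 → ℝ}
    (hr : ∀ j : Fin 3, |(U y) j| ≤ r j)
    (hκ : ∀ k : Fin 3, ∑ j : Fin 3, |(U (EuclideanSpace.single j (1 : ℝ))) k - (if k = j then (1 : ℝ) else 0)| ≤ κ k) (k : Fin 3) :
    |y k| ≤ r k + κ k * (4 / 3 * Real.sqrt (∑ j : Fin 3, r j ^ 2)) := by
  -- `‖U y‖ ≤ √(Σ r_j²)`
  have hr0 : ∀ j, 0 ≤ r j := fun j => (abs_nonneg _).trans (hr j)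
  have hUy : ‖U y‖ ≤ Real.sqrt (∑ j : Fin 3, r j ^ 2) := by
    rw [← Real.sqrt_sq (norm_nonneg (U y)), EuclideanSpace.norm_sq_eq]
    refine Real.sqrt_le_sqrt (Finset.sum_le_sum fun j _ => ?_)
    rw [Real.norm_eq_abs, sq_abs, ← sq_abs]
    exact pow_le_pow_left₀ (abs_nonneg _) (hr j) 2
  have hy : ‖y‖ ≤ 4 / 3 * Real.sqrt (∑ j : Fin 3, r j ^ 2) := by
    have h34 : (1 - 1 / 4) * ‖y‖ ≤ ‖U y‖ := norm_apply_ge_of_norm_sub_one_le hU y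
    linarith
  -- `((U − 1) y)_k = Σ_j (U_kj − δ_kj) y_j`
  have hyk : y k = ∑ j : Fin 3, (if k = j then (1 : ℝ) else 0) * y j := by
    simp only [ite_mul, one_mul, zero_mul, Finset.sum_ite_eq, Finset.mem_univ, if_true]
  have hdev : (U y) k - y k = ∑ j : Fin 3, ((U (EuclideanSpace.single j (1 : ℝ))) k - (if k = j then (1 : ℝ) else 0)) * y j := by
    conv_lhs => rw [apply_eq_sum_entries U y k, hyk]
    rw [← Finset.sum_sub_distrib]
    exact Finset.sum_congr rfl fun j _ => by ring
  have hyj : ∀ j, |y j| ≤ ‖y‖ := fun j => abs_le.2 (coord_mem_cube_of_norm_le le_rfl j)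
  have hbound : |(U y) k - y k| ≤ κ k * ‖y‖ := by
    rw [hdev]
    calc |∑ j : Fin 3, ((U (EuclideanSpace.single j (1 : ℝ))) k - (if k = j then (1 : ℝ) else 0)) * y j|
        ≤ ∑ j : Fin 3, |((U (EuclideanSpace.single j (1 : ℝ))) k - (if k = j then (1 : ℝ) else 0)) * y j| := Finset.abs_sum_le_sum_abs _ _
      _ ≤ ∑ j : Fin 3, |(U (EuclideanSpace.single j (1 : ℝ))) k - (if k = j then (1 : ℝ) else 0)| * ‖y‖ :=
          Finset.sum_le_sum fun j _ => by rw [abs_mul]; exact mul_le_mul_of_nonneg_left (hyj j) (abs_nonneg _)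
      _ = (∑ j : Fin 3, |(U (EuclideanSpace.single j (1 : ℝ))) k - (if k = j then (1 : ℝ) else 0)|) * ‖y‖ := by rw [Finset.sum_mul]
      _ ≤ κ k * ‖y‖ := mul_le_mul_of_nonneg_right (hκ k) (norm_nonneg _)
  have hκ0 : 0 ≤ κ k := (Finset.sum_nonneg fun j _ => abs_nonneg _).trans (hκ k)
  have h1 : |y k| ≤ |(U y) k| + |(U y) k - y k| := by
    have h := abs_sub ((U y) k) ((U y) k - y k)
    rwa [sub_sub_cancel] at h
  calc |y k| ≤ |(U y) k| + |(U y) k - y k| := h1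
    _ ≤ r k + κ k * ‖y‖ := add_le_add (hr k) hbound
    _ ≤ r k + κ k * (4 / 3 * Real.sqrt (∑ j : Fin 3, r j ^ 2)) := by nlinarith [hy, hκ0]

/-! ## §3. ★★★ The `hver` conclusion from the slab parts -/

/-- ★★★ **THE `hver` CONCLUSION FROM THE SLAB PARTS** at one point `(U, ξ)` (`‖U − 1‖ ≤ 1/4`, `‖ξ₀‖, ‖ξ‖ ≤ 1/4`): a certainly-inside label finset
`B ⊆ [−11,11]³`, the straddlers in `R` and `≥ 6` from the centre, a curvature floor `q ≤ Σ_B segGd` along the segment from the reference shuffle `ξ₀`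
(any real `q`; §1 supplies the certified Q-form value), the reference force bound `f₀`, and «SLAB ⟹ CONCLUSION» — if `q ≤ (S₇♯(7) + f₀ + |R|·6⁻⁷)‖U(ξ−ξ₀)‖`
then the `hver` conclusion holds (the leaf: confinement §2 + `…HomSlabConfine` + the inner verdict on the confined box) — give the `hver` conclusion: the
dichotomy `Tight ∨ Exempt ∨ Bad` for EVERY injective enumeration of the homogeneous hcp `133/10`-ball, or the energy floor `μ/SC`.  Outside the slab the
exempt disjunct serves every enumeration (`…HomExemptZeroStep.slab_or_exempt_of_ring`). [folklore chaining] -/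
theorem hver_of_slabParts {μ : ℤ} {U : E3 →L[ℝ] E3} {ξ₀ ξ : E3} (hU : ‖U - 1‖ ≤ 1 / 4) (hξ₀ : ‖ξ₀‖ ≤ 1 / 4) (hξ : ‖ξ‖ ≤ 1 / 4)
    (B R : Finset (Fin 3 → ℤ)) (hB : B ⊆ Fintype.piFinset fun _ : Fin 3 => Finset.Icc (-11 : ℤ) 11)
    (hBin : ∀ bb ∈ B, ‖latPt U hexFrame bb + U (hcpShift + ξ)‖ ≤ 7)
    (hR : ∀ bb ∈ (Fintype.piFinset fun _ : Fin 3 => Finset.Icc (-11 : ℤ) 11) \ B, ‖latPt U hexFrame bb + U (hcpShift + ξ)‖ ≤ 7 →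
      bb ∈ R ∧ 6 ≤ ‖latPt U hexFrame bb + U (hcpShift + ξ)‖)
    {q f₀ : ℝ}
    (hcurv : ∀ s ∈ Set.Ioo (0 : ℝ) 1, q ≤
      ∑ bb ∈ B, segGd (fun x : ℝ => x⁻¹ ^ 7 - x⁻¹ ^ 13) (latPt U hexFrame bb + U (hcpShift + ξ₀)) (U (ξ - ξ₀)) s)
    (hf₀ : |∑ bb ∈ B, (‖latPt U hexFrame bb + U (hcpShift + ξ₀)‖⁻¹ ^ 8 - ‖latPt U hexFrame bb + U (hcpShift + ξ₀)‖⁻¹ ^ 14) *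
        ⟪latPt U hexFrame bb + U (hcpShift + ξ₀), U (ξ - ξ₀)⟫| ≤ f₀ * ‖U (ξ - ξ₀)‖)
    (hslab : q ≤ ((6000 / 343 * (7 : ℝ)⁻¹ ^ 4 + 2880 / 49 * (7 : ℝ)⁻¹ ^ 5 + 10 / 7 * (7 : ℝ)⁻¹ ^ 6 + 2 * (7 : ℝ)⁻¹ ^ 7) + f₀ +
        R.card * (6 : ℝ)⁻¹ ^ 7) * ‖U (ξ - ξ₀)‖ →
      (∀ (M : ℕ) (z : Fin M → E3) (cc : Fin M), Function.Injective z →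
          Set.range z = {x : E3 | dist x (z cc) ≤ 133 / 10 ∧ ∃ a : Fin 3 → ℤ,
            x = z cc + latPt U hexFrame a ∨ x = z cc + latPt U hexFrame a + U (hcpShift + ξ)} →
          TightNearCap (9 / 5) (3 / 2) z cc ∨ ExemptNear (9 / 5) ExRec z cc ∨ BadNearCap (9 / 5) (3 / 2) z cc) ∨
        (μ : ℝ) / SC ≤ ∑ b ∈ (Fintype.piFinset fun _ : Fin 3 => Finset.Icc (-7 : ℤ) 7).filter (fun b => b ≠ 0), effPot w₄₅ ω₄ (3 / 400) ‖latPt U hexFrame b‖ +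
          ∑ b ∈ (Fintype.piFinset fun _ : Fin 3 => Finset.Icc (-7 : ℤ) 7), effPot w₄₅ ω₄ (3 / 400) ‖latPt U hexFrame b + U (hcpShift + ξ)‖) :
    (∀ (M : ℕ) (z : Fin M → E3) (cc : Fin M), Function.Injective z →
        Set.range z = {x : E3 | dist x (z cc) ≤ 133 / 10 ∧ ∃ a : Fin 3 → ℤ,
          x = z cc + latPt U hexFrame a ∨ x = z cc + latPt U hexFrame a + U (hcpShift + ξ)} →
        TightNearCap (9 / 5) (3 / 2) z cc ∨ ExemptNear (9 / 5) ExRec z cc ∨ BadNearCap (9 / 5) (3 / 2) z cc) ∨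
      (μ : ℝ) / SC ≤ ∑ b ∈ (Fintype.piFinset fun _ : Fin 3 => Finset.Icc (-7 : ℤ) 7).filter (fun b => b ≠ 0), effPot w₄₅ ω₄ (3 / 400) ‖latPt U hexFrame b‖ +
        ∑ b ∈ (Fintype.piFinset fun _ : Fin 3 => Finset.Icc (-7 : ℤ) 7), effPot w₄₅ ω₄ (3 / 400) ‖latPt U hexFrame b + U (hcpShift + ξ)‖ := by
  by_cases hq : q ≤ ((6000 / 343 * (7 : ℝ)⁻¹ ^ 4 + 2880 / 49 * (7 : ℝ)⁻¹ ^ 5 + 10 / 7 * (7 : ℝ)⁻¹ ^ 6 + 2 * (7 : ℝ)⁻¹ ^ 7) + f₀ +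
      R.card * (6 : ℝ)⁻¹ ^ 7) * ‖U (ξ - ξ₀)‖
  · exact hslab hq
  · refine Or.inl fun M z cc hz hrange => ?_
    rcases slab_or_exempt_of_ring hz hU hξ₀ hξ hrange B R hB hBin hR hcurv hf₀ with h | h
    · exact absurd h hq
    · exact Or.inr (Or.inl h)

end Summit.AtomisticToContinuum.Crystallization.Theorems.FrustratedLawDichotomyStrainedPatchHomSlabLeaf

end
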